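import Summits.ABC.IUTFork.Thm311RealInd1StripPrimeStrictnessDyadicTraceClass
import Summits.ABC.IUTFork.Thm311RealInd1StripGlobalStrictnessDyadicWitnessIndTwoSwap
import HarnessLib

/-!
# (ψ5″) CALIBRATED at the dyadic packet: {factorwise} ⊊ {trace-scaling} ⊊ `indTwo` AS TYPED — explicit members on both sides of both boundaries
# (C-R232 §5 / C-R241 (2), row R40 «C:PSI5-TRACE-CLASS»; UNCONDITIONAL)

PROOF-ONLY file (abc-iut cell; seat abc-iut-2r-A «two-readings A»; the OPTIONAL calibration (γ″) of the C LEAD's C-R241 (2) for the trace-scaling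
class (ψ5″) of ★ p643111 / ★ p643942).  TAKES NO SIDE on [IUTchIII] Cor. 3.12.  No definition, no `Prop` fact, no instance, no notation, no attribute;
every witness is an EXPLICIT map (no choice beyond a uniformizer name), built inside the proofs.

* §1 (ANY packet `X = ⊗_{ℚ₂} k_b` all of whose factors have `ι_b² = −1`, `(e, f) = (2, 1)` — the all-`ℚ₂(√−1)` packets of gen 24/27, the genuine
  dyadic packet included) **`exists_mem_indTwo_not_traceScaling`** — the OUTER boundary is inhabited: LEFT MULTIPLICATION BY THE PURE UNIT TENSOR
  `ι_{b₀}(√−1) = 1 ⊗ ⋯ ⊗ √−1 ⊗ ⋯ ⊗ 1` lies in OUR container `indTwo` (`log₂(R_I^×) = ⊗_b 𝔪_b³` is stable under unit pure tensors: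
  `DyadicNoFixedBall.logUnits_eq_closedBall_cube_of_sq_eq_neg_one`) and scales the packet trace by NO `u ∈ ℚ₂` at all (`Tr_X(ι_{b₀}(√−1)) = 0` by
  `trace_eq_zero_of_sq_eq_neg_one_two`, while `Tr_X((ι_{b₀}√−1)²) = Tr_X(−1) = −dim X ≠ 0`); hence **`indTwo_not_traceScaling`**: (ψ5″)'s hypothesis
  `hHtr` FAILS at `H ≡ indTwo` — the open residual «non-trace-scaling members of OUR `indTwo`» is NON-EMPTY BY NAME.
* §2 (`p`-GENERIC; constant packet `⊗_{b ∈ Fin (n+2)} K₀`, `[K₀ : ℚ_p] ≥ 2` — e.g. a repeated dyadic place) **`trace_reindex`** — factor permutations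
  are ALGEBRA automorphisms of the packet, hence PRESERVE `Tr_{X/ℚ_p}` (`Algebra.trace_eq_of_algEquiv`); with abc-iut-c312-1 R39c-swap's
  `swap_mem_indTwo` / `swap_not_factorwise` (`Thm311RealInd1StripGlobalStrictnessDyadicWitnessIndTwoSwap.lean:90/103`):
  **`exists_mem_indTwo_tracePreserving_not_factorwise`** — the INNER boundary is inhabited: the factor swap is a trace-scaling (`u = 1`) member of
  `indTwo` that acts on pure tensors through NO family of maps `F_b : K₀ → K₀`, so it lies in neither factorwise class (gen 27's strip class, gen 15's
  print-(Ind1)⊔(Ind2) class) — the class gain of (ψ5″) over (ψ5) is STRICT BY NAME.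
READING (numbers about OUR typed objects; neutral): at the dyadic packets of record, {factorwise members} ⊊ {trace-scaling members} ⊊ `indTwo` with
explicit members in both gaps; whether a NON-trace-scaling member (e.g. `x ↦ ι_{b₀}(√−1)·x`) FILLS the container hull at one collection is the further
bounded certificate C-R232 names and is NOT decided here.  HONEST SCOPE: OUR `indTwo` / OUR `log₂(R_I^×)` / OUR packets; equal-AS-TYPED ≠ equal in print;
located ≠ adjudicated; nothing about print's (Ind2); DISCHARGES NOTHING on `stub_cor312PerImage` / `ThetaPartII` (RESHAPE-4 untouched; (β2)/(α2)/(γ2)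
HELD); no side taken on [IUTchIII] Cor. 3.12 / Thm. 3.11 / [IUTchIV] Thm. 1.10, (U) vs (P), or on any author; IUT is DISPUTED in print
(`Literature/Barriers/ABC/IUTDisputedClaim.lean`); nothing here asserts that abc or Szpiro is proved or refuted. [claim: Mochizuki2012, status: disputed];
[cite: Mochizuki2012, IUTchIII Thm. 3.11 (i) (Ind1)(Ind2) p. 154; IUTchIV Prop. 1.2 (i) pp. 10–11, Prop. 1.4 (i) p. 13]; [cite: DupuyHilado2025, §4.9];
[cite: NeukirchANT1999, Ch. II Prop. (5.5), (5.7)]. typed ≠ proved; calibrated ≠ discharged.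
-/

set_option autoImplicit false

noncomputable section

open Metric Set Function Module
open scoped Pointwise TensorProduct

namespace Summit.ABC.IUTFork.Thm311.Real.TraceClassCalibration

open Literature.IUT.LogVolume Literature.NumberTheory.GaloisRepresentations Literature.NumberTheory.GaloisRepresentations.Ultrametric
open Literature.IUT.LogVolume.TraceZeroDyadicSqrtNegOne

/-! ## §1 The OUTER boundary: a member of `indTwo` that is NOT trace-scaling (all-`ℚ₂(√−1)` packet) -/

section Outer

variable {I : Type} [Fintype I] [DecidableEq I]
variable (k : I → Type) [∀ b, NontriviallyNormedField (k b)] [∀ b, NormedAlgebra ℚ_[2] (k b)]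
  [∀ b, IsUltrametricDist (k b)] [∀ b, ProperSpace (k b)]
variable {ι : Π b, k b} (hι : ∀ b, ι b ^ 2 = -1) (he : ∀ b, absRamificationIdx 2 (k b) = 2) (hf : ∀ b, residueDegree 2 (k b) = 1)
  {ϖ : Π b, (k b)ˣ} (hϖ : ∀ b, IsUniformizer (ϖ b))

include hι he hf hϖ

/-- **A member of OUR `indTwo` that is NOT trace-scaling (UNCONDITIONAL; any all-`ℚ₂(√−1)` packet, any slot `b₀`).**  Left multiplication by the pure
unit tensor `m = ι_{b₀}(√−1)` (`m² = −1`, so its inverse is `−m`) maps `log₂(R_I^×) = ⊗_b 𝔪_b³` onto itself — on generators `⊗ z_b ↦ ⊗ z'_b` with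
`z'_{b₀} = √−1·z_{b₀}` of the same norm — hence lies in `indTwo`; and `Tr_X(m·x) = u·Tr_X(x)` for all `x` is impossible for EVERY `u ∈ ℚ₂`: at `x = 1` it
gives `u = 0` (`Tr_X(m) = Tr(√−1)·Π_{b ≠ b₀} Tr(1) = 0`), at `x = m` it gives `Tr_X(−1) = 0`, i.e. `dim X = 0`. [cite: Mochizuki2012, IUTchIV Prop. 1.2 (i) pp. 10–11]
[cite: DupuyHilado2025, §4.9] [cite: NeukirchANT1999, Ch. II Prop. (5.5)] -/
theorem exists_mem_indTwo_not_traceScaling (b₀ : I) :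
    ∃ γ ∈ indTwo 2 k, ¬ ∃ u : ℚ_[2], ∀ x,
      Algebra.trace ℚ_[2] (PacketAlgebra 2 k) (γ x) = u * Algebra.trace ℚ_[2] (PacketAlgebra 2 k) x := by
  classical
  haveI : ∀ b, FiniteDimensional ℚ_[2] (k b) := fun b => finiteDimensional 2 (k b)
  set m : PacketAlgebra 2 k := iota 2 k b₀ (ι b₀) with hm
  have hmm : m * m = -1 := by
    rw [hm, ← map_mul, ← sq, hι b₀, map_neg, map_one]
  -- `T = (x ↦ m·x)`, inverse `x ↦ −(m·x)`
  have hmmx : ∀ x : PacketAlgebra 2 k, m * (m * x) = -x := fun x => by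
    rw [← mul_assoc, hmm, neg_one_mul]
  have h₁ : (LinearMap.mulLeft ℚ_[2] m).comp (-LinearMap.mulLeft ℚ_[2] m) = LinearMap.id :=
    LinearMap.ext fun x => by
      change m * -(m * x) = x
      rw [mul_neg, hmmx, neg_neg]
  have h₂ : (-LinearMap.mulLeft ℚ_[2] m).comp (LinearMap.mulLeft ℚ_[2] m) = LinearMap.id :=
    LinearMap.ext fun x => by
      change -(m * (m * x)) = x
      rw [hmmx, neg_neg]
  let T : PacketAlgebra 2 k ≃ₗ[ℚ_[2]] PacketAlgebra 2 k :=
    LinearEquiv.ofLinear (LinearMap.mulLeft ℚ_[2] m) (-LinearMap.mulLeft ℚ_[2] m) h₁ h₂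
  have hT : ∀ x, T x = m * x := fun x => rfl
  -- `m · log₂(R_I^×) ⊆ log₂(R_I^×)`
  have hmul : ∀ x ∈ logPacket 2 k, m * x ∈ logPacket 2 k := by
    intro x hx
    unfold logPacket at hx ⊢
    refine AddSubgroup.closure_induction (fun y hy => ?_) ?_ (fun y y' _ _ hy hy' => ?_) (fun y _ hy => ?_) hx
    · obtain ⟨z, hz, rfl⟩ := hy
      rw [hm, iota_eq_purePacket, purePacket_mul]
      refine AddSubgroup.subset_closure ⟨Pi.mulSingle b₀ (ι b₀) * z, fun b => ?_, rfl⟩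
      rw [Pi.mul_apply]
      by_cases hb : b = b₀
      · subst hb
        have hzb := hz b
        rw [DyadicNoFixedBall.logUnits_eq_closedBall_cube_of_sq_eq_neg_one (hϖ b) (hι b) (he b) (hf b),
          mem_closedBall_zero_iff] at hzb ⊢
        rw [Pi.mulSingle_eq_same, norm_mul, norm_eq_one_of_sq_eq_neg_one (hι b), one_mul]
        exact hzb
      · rw [Pi.mulSingle_eq_of_ne hb, one_mul]
        exact hz b
    · rw [mul_zero]
      exact AddSubgroup.zero_mem _
    · rw [mul_add]
      exact AddSubgroup.add_mem _ hy hy'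
    · rw [mul_neg]
      exact AddSubgroup.neg_mem _ hy
  refine ⟨T, ?_, ?_⟩
  · -- `T ∈ indTwo`
    rw [mem_indTwo_iff]
    intro x
    rw [hT]
    refine ⟨fun hmx => ?_, fun hx => hmul x hx⟩
    have h := hmul _ hmx
    rw [← mul_assoc, hmm, neg_one_mul] at h
    exact neg_mem_iff.mp h
  · -- not trace-scaling
    rintro ⟨u, hu⟩
    have hfin : ∀ b, Module.finrank ℚ_[2] (k b) = 2 := fun b => finrank_eq_two_of_invariants (he b) (hf b)
    have hTrm : Algebra.trace ℚ_[2] (PacketAlgebra 2 k) m = 0 := by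
      rw [hm, iota_eq_purePacket, trace_purePacket]
      refine Finset.prod_eq_zero (Finset.mem_univ b₀) ?_
      rw [Pi.mulSingle_eq_same]
      exact trace_eq_zero_of_sq_eq_neg_one_two (hι b₀) (hfin b₀)
    have hTr1 : Algebra.trace ℚ_[2] (PacketAlgebra 2 k) 1 ≠ 0 := by
      rw [← purePacket_one, trace_purePacket]
      refine Finset.prod_ne_zero_iff.mpr fun b _ => ?_
      rw [Pi.one_apply, ← map_one (algebraMap ℚ_[2] (k b)), Algebra.trace_algebraMap, hfin b]
      norm_num
    have h1 := hu 1
    rw [hT, mul_one, hTrm] at h1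
    have hu0 : u = 0 := (mul_eq_zero.mp h1.symm).resolve_right hTr1
    have h2 := hu m
    rw [hT, hmm, hu0, zero_mul, map_neg, neg_eq_zero] at h2
    exact hTr1 h2

/-- **Hence (ψ5″)'s hypothesis FAILS at `H ≡ indTwo`** (any all-`ℚ₂(√−1)` packet with a slot): OUR full container is NOT in the trace-scaling class —
the open residual of the p = 2 strictness ledger («non-trace-scaling members of `indTwo`») is inhabited by name.  (R39c's `not_hHfac_indTwo` is the
factorwise analogue.) [cite: DupuyHilado2025, §4.9] [cite: Mochizuki2012, IUTchIII Thm. 3.11 (i) p. 154] -/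
theorem indTwo_not_traceScaling (b₀ : I) :
    ¬ ∀ γ ∈ indTwo 2 k, ∃ u : ℚ_[2], ‖u‖ ≤ 1 ∧ ∀ x,
      Algebra.trace ℚ_[2] (PacketAlgebra 2 k) (γ x) = u * Algebra.trace ℚ_[2] (PacketAlgebra 2 k) x := by
  intro h
  obtain ⟨γ, hγ, hnot⟩ := exists_mem_indTwo_not_traceScaling k hι he hf hϖ b₀
  obtain ⟨u, -, hu⟩ := h γ hγ
  exact hnot ⟨u, hu⟩

end Outer

/-! ## §2 The INNER boundary: a trace-PRESERVING member of `indTwo` that is NOT factorwise (`p`-generic; constant packet with `[K₀ : ℚ_p] ≥ 2`) -/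

section Inner

variable (p : ℕ) [Fact p.Prime] (k₀ : Type) [NontriviallyNormedField k₀] [NormedAlgebra ℚ_[p] k₀]

/-- **Factor permutations PRESERVE the packet trace** (`p`-generic; any index type): the re-indexing `⊗_b z_b ↦ ⊗_b z_{e⁻¹ b}` of `⊗_{b} K₀` is
multiplicative and unital, i.e. an ALGEBRA automorphism over `ℚ_p` (`AlgEquiv.ofLinearEquiv`), so `Tr_{X/ℚ_p} ∘ reindex = Tr_{X/ℚ_p}`
(`Algebra.trace_eq_of_algEquiv`). [cite: NeukirchANT1999, Ch. II Prop. (5.5)] [cite: Mochizuki2012, IUTchIV Prop. 1.2 (i) pp. 10–11] -/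
theorem trace_reindex {J : Type} [Fintype J] [DecidableEq J] (e : J ≃ J) (x : PacketAlgebra p (fun _ : J => k₀)) :
    Algebra.trace ℚ_[p] (PacketAlgebra p (fun _ : J => k₀)) (PiTensorProduct.reindex ℚ_[p] (fun _ : J => k₀) e x) =
      Algebra.trace ℚ_[p] (PacketAlgebra p (fun _ : J => k₀)) x := by
  set R := PiTensorProduct.reindex ℚ_[p] (fun _ : J => k₀) e with hR
  have map_one : R 1 = 1 := by
    rw [hR, PiTensorProduct.one_def, PiTensorProduct.reindex_tprod]
    rfl
  have map_mul : ∀ x y, R (x * y) = R x * R y := by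
    intro x y
    induction x using PiTensorProduct.induction_on with
    | smul_tprod r a =>
      induction y using PiTensorProduct.induction_on with
      | smul_tprod s b =>
        rw [PiTensorProduct.smul_tprod_mul_smul_tprod, map_smul, map_smul, map_smul, hR, PiTensorProduct.reindex_tprod,
          PiTensorProduct.reindex_tprod, PiTensorProduct.reindex_tprod, PiTensorProduct.smul_tprod_mul_smul_tprod]
        rfl
      | add y₁ y₂ h₁ h₂ => rw [mul_add, map_add, h₁, h₂, map_add, mul_add]
    | add x₁ x₂ h₁ h₂ => rw [add_mul, map_add, h₁, h₂, map_add, add_mul]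
  exact Algebra.trace_eq_of_algEquiv (AlgEquiv.ofLinearEquiv R map_one map_mul) x

/-- **A trace-preserving member of OUR `indTwo` that is NOT factorwise** (`p`-generic; `[K₀ : ℚ_p] ≥ 2`; constant packet on `n + 2 ≥ 2` slots, e.g. a
repeated place): the SWAP of the factors `0` and `1` lies in `indTwo` (R39c-swap `swap_mem_indTwo`), preserves `Tr_{X/ℚ_p}` (§2, so it is trace-scaling with
`u = 1`), and acts on pure tensors through NO family of maps `F_b : K₀ → K₀` (R39c-swap `swap_not_factorwise`) — so it lies in neither factorwise class of
record (gen 27's strip class, gen 15's print-(Ind1)⊔(Ind2) class, both of which act slot by slot). [cite: DupuyHilado2025, §4.9]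
[cite: Mochizuki2012, IUTchIV Prop. 1.2 (i) pp. 10–11] -/
theorem exists_mem_indTwo_tracePreserving_not_factorwise (h2 : 2 ≤ Module.finrank ℚ_[p] k₀) (n : ℕ) :
    ∃ γ ∈ indTwo p (fun _ : Fin (n + 2) => k₀),
      (∀ x, Algebra.trace ℚ_[p] (PacketAlgebra p (fun _ : Fin (n + 2) => k₀)) (γ x) =
          Algebra.trace ℚ_[p] (PacketAlgebra p (fun _ : Fin (n + 2) => k₀)) x) ∧
        ∀ F : Fin (n + 2) → k₀ → k₀, ¬ ∀ z : Fin (n + 2) → k₀,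
          γ (PiTensorProduct.tprod ℚ_[p] z) = PiTensorProduct.tprod ℚ_[p] (fun b => F b (z b)) :=
  ⟨PiTensorProduct.reindex ℚ_[p] (fun _ : Fin (n + 2) => k₀) (Equiv.swap (0 : Fin (n + 2)) 1),
    IndTwoSwap.swap_mem_indTwo p k₀ n, fun x => trace_reindex p k₀ _ x, fun F => IndTwoSwap.swap_not_factorwise p k₀ h2 n F⟩

/-- The same member in (ψ5″)'s currency: it satisfies the trace-scaling clause `hHtr` (with `u = 1`, `‖u‖ ≤ 1`) and is not factorwise. [cite: DupuyHilado2025, §4.9] -/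
theorem exists_mem_indTwo_traceScaling_not_factorwise (h2 : 2 ≤ Module.finrank ℚ_[p] k₀) (n : ℕ) :
    ∃ γ ∈ indTwo p (fun _ : Fin (n + 2) => k₀),
      (∃ u : ℚ_[p], ‖u‖ ≤ 1 ∧ ∀ x, Algebra.trace ℚ_[p] (PacketAlgebra p (fun _ : Fin (n + 2) => k₀)) (γ x) =
          u * Algebra.trace ℚ_[p] (PacketAlgebra p (fun _ : Fin (n + 2) => k₀)) x) ∧
        ∀ F : Fin (n + 2) → k₀ → k₀, ¬ ∀ z : Fin (n + 2) → k₀,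
          γ (PiTensorProduct.tprod ℚ_[p] z) = PiTensorProduct.tprod ℚ_[p] (fun b => F b (z b)) := by
  obtain ⟨γ, hγ, htr, hnf⟩ := exists_mem_indTwo_tracePreserving_not_factorwise p k₀ h2 n
  exact ⟨γ, hγ, ⟨1, norm_one.le, fun x => by rw [one_mul]; exact htr x⟩, hnf⟩

end Inner

/-! ## §3 AT A GENUINE Θ-VOLUME INPUT: both boundaries at the genuine dyadic collection packets, BY NAME -/

section Input

open Literature.NumberTheory.NumberFields NumberField IsDedekindDomain

variable {F₀ : Type} [Field F₀] [NumberField F₀] {K : Type} [Field K] [NumberField K] [Algebra F₀ K]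
variable (I : ThetaVolumeInput F₀ K)

/-- **OUTER boundary at a genuine input** (`K ∋ s`, `s² = −1`, every section place over `2` of local degree `2` — the hypotheses of ★ p643942): at EVERY
dyadic collection `e` (any length `n + 1 ≥ 1`, any slot `b₀`) OUR full `indTwo` is NOT trace-scaling, i.e. (ψ5″)'s `hHtr` fails at `H ≡ indTwo` there —
§1 with the per-factor data read off `s` and `localDeg = 2` as in gen 27 file 3/3. [cite: DupuyHilado2025, §4.9] [cite: Mochizuki2012, IUTchI Def. 3.1 (a) p. 61;
IUTchIII Thm. 3.11 (i) p. 154] -/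
theorem input_indTwo_not_traceScaling {s : K} (hs : s ^ 2 = -1) (hd : ∀ w : placesOver F₀ 2, localDeg K (I.σ.lift w.1) = 2)
    {n : ℕ} (e : Fin (n + 1) → placesOver F₀ 2) (b₀ : Fin (n + 1)) :
    ¬ ∀ γ ∈ indTwo 2 (fun b => (I.σ.localFields 2).k (e b)), ∃ u : ℚ_[2], ‖u‖ ≤ 1 ∧ ∀ x,
      Algebra.trace ℚ_[2] (PacketAlgebra 2 (fun b => (I.σ.localFields 2).k (e b))) (γ x) =
        u * Algebra.trace ℚ_[2] (PacketAlgebra 2 (fun b => (I.σ.localFields 2).k (e b))) x := by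
  have hι : ∀ b, (RescaledCompletion.of K 2 (I.σ.lift (e b).1) (I.σ.natCast_mem_lift (e b))
      (algebraMap K ((I.σ.lift (e b).1).adicCompletion K) s)) ^ 2 = -1 :=
    fun b => sq_of_algebraMap_eq_neg_one' (I.σ.lift (e b).1) (I.σ.natCast_mem_lift (e b)) hs
  have hef := fun b => absRamificationIdx_eq_two_and_residueDegree_eq_one_of_localDeg_eq_two (I.σ.lift (e b).1)
    (I.σ.natCast_mem_lift (e b)) (hι b) (hd (e b))
  have hϖex := fun b => exists_isUniformizer (F := (I.σ.localFields 2).k (e b))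
  choose ϖ hϖ using hϖex
  exact indTwo_not_traceScaling (fun b => (I.σ.localFields 2).k (e b)) hι (fun b => (hef b).1) (fun b => (hef b).2) hϖ b₀

/-- **INNER boundary at a genuine input** (`p`-generic): at the CONSTANT collection `v⃗ ≡ w` of length `n + 2` over a section place of local degree
`[K_{w̲} : ℚ_p] ≥ 2`, OUR `indTwo` has a trace-scaling (`u = 1`) member acting on pure tensors through NO family of maps — the factor swap
(§2 + R39c-swap `exists_mem_indTwo_const_not_factorwise`'s degree bookkeeping `PlaceSection.finrank_localFields_k`). [cite: DupuyHilado2025, §4.9, Def. 3.6.1]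
[cite: NeukirchANT1999, Ch. II Prop. (6.8)] -/
theorem input_exists_mem_indTwo_traceScaling_not_factorwise (p : ℕ) [Fact p.Prime] (w : placesOver F₀ p)
    (hd : 2 ≤ localDeg K (I.σ.lift w.1)) (n : ℕ) :
    ∃ γ ∈ indTwo p (fun _ : Fin (n + 2) => (I.σ.localFields p).k w),
      (∃ u : ℚ_[p], ‖u‖ ≤ 1 ∧ ∀ x,
          Algebra.trace ℚ_[p] (PacketAlgebra p (fun _ : Fin (n + 2) => (I.σ.localFields p).k w)) (γ x) =
            u * Algebra.trace ℚ_[p] (PacketAlgebra p (fun _ : Fin (n + 2) => (I.σ.localFields p).k w)) x) ∧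
        ∀ F : Fin (n + 2) → (I.σ.localFields p).k w → (I.σ.localFields p).k w, ¬ ∀ z : Fin (n + 2) → (I.σ.localFields p).k w,
          γ (PiTensorProduct.tprod ℚ_[p] z) = PiTensorProduct.tprod ℚ_[p] (fun b => F b (z b)) :=
  exists_mem_indTwo_traceScaling_not_factorwise p ((I.σ.localFields p).k w)
    (by rw [PlaceSection.finrank_localFields_k]; exact hd) n

end Input

end Summit.ABC.IUTFork.Thm311.Real.TraceClassCalibration

end
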